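import Summits.CriticalPhenomena.PercolationContinuityZ3.Theorems.PercNearOneGluingNearOneGluingQ7ThreeCutAux

/-!
# Crux `PercNearOneGluing.NearOneGluing` (stmt-CriticalPhenomena-4574), line `SketchR2I5` —
# Kozma–Nitzan Question 7 for THREE relays, part III: `(R3″)` from the summed slack inequality `S12`

Lead prover-line-stmt-CriticalPhenomena-4574-c6 (cycle 6), stub `stub_r3ppOfS12`.  Lands
`--supports stmt-CriticalPhenomena-4574`; no definitions, no named facts.

## Content

Finite weighted graph on `Fin n` (`μ = prodBernoulli w`), source `o`, target `b`, relays `x, y, z` with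
`μ(z ↔ b) ≤ μ(y ↔ b)`.  Notation: `D := {y ↮ z}`, `D_a := {x ↮ y} ∩ {x ↮ z}`, `W := D_a ∩ {o ↔ x}`, and for an
event `Q` (here `Q = {x ↔ y}` or `Q = {o ↔ y}`)
`L(Q) := μ(Q ∩ ({y↔b} ∖ {z↔b})) − μ(Q ∩ ({z↔b} ∖ {y↔b}))`,
`s12(Q) := μ(D)·(μ(Q ∩ {y↔b} ∩ D) − μ(Q ∩ {z↔b} ∩ D)) − μ(Q ∩ D)·(μ(y↔b) − μ(z↔b))`.

* `r3pp_inter_conn_inter_compl_eq(')`: `Q ∩ {y↔b} ∩ D = Q ∩ ({y↔b} ∖ {z↔b})` and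
  `Q ∩ {z↔b} ∩ D = Q ∩ ({z↔b} ∖ {y↔b})` (given `y ↔ b`: `y ↮ z ⟺ z ↮ b`), so that
  `L(Q) = μ(Q ∩ {y↔b} ∩ D) − μ(Q ∩ {z↔b} ∩ D)` and `μ(D)·L(Q) = s12(Q) + μ(Q ∩ D)·(μ(y↔b) − μ(z↔b))`;
* `r3pp_t1` (T1): `μ(W)·μ({x↔y} ∩ D) ≤ μ(D_a)·μ({o↔y} ∩ D)`.  With `E := {x ↮ z}`, van den Berg–Häggström–Kahn's
  Theorem 1.3 for the cluster of `x` given `E` and the increasing cluster functions `1{x↔o}`, `1{x↔y}`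
  (`knLemma3i_oneCluster`) gives `μ(E ∩ {o↔x})·μ(E ∩ {x↔y}) ≤ μ(E)·μ(E ∩ {o↔x} ∩ {x↔y})`; combine with the
  set identities `{x↔y} ∩ D = E ∩ {x↔y}`, `E ∩ {o↔x} ∩ {x↔y} ⊆ {o↔y} ∩ D`, `D_a = E ∖ {x↔y}`,
  `W = (E ∩ {o↔x}) ∖ {x↔y}`;
* `r3pp_of_s12`: if `μ(W)·s12({x↔y}) ≤ μ(D_a)·s12({o↔y})` then `μ(W)·L({x↔y}) ≤ μ(D_a)·L({o↔y})`, since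
  `μ(D)·[μ(D_a)·L(oy) − μ(W)·L(xy)]
     = [μ(D_a)·s12(oy) − μ(W)·s12(xy)] + (μ(y↔b) − μ(z↔b))·[μ(D_a)·μ(oy ∩ D) − μ(W)·μ(xy ∩ D)] ≥ 0`
  by the hypothesis, `μ(z↔b) ≤ μ(y↔b)` and (T1), while for `μ(D) = 0` all four `L`-terms vanish;
* the registered stub form `stub_r3ppOfS12`.
[cite: KozmaNitzan2024, Question 7 (p. 36)]
[cite: VandenbergHaggstromKahn2005, Thm. 1.3 (p. 6)]
-/

namespace Summit.CriticalPhenomena.PercolationContinuityZ3.Theorems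

open MeasureTheory Set Literature.Probability.LatticeModels Literature.Probability.Percolation
open scoped Classical BigOperators
open Q7ThreeCut

noncomputable section

variable {n : ℕ}

/-! ### Set identities (I1) -/

/-- `Q ∩ {y↔b} ∩ {y↮z} = Q ∩ ({y↔b} ∖ {z↔b})`: given `y ↔ b`, `y ↮ z ⟺ z ↮ b`. [folklore] -/
theorem r3pp_inter_conn_inter_compl_eq (Q : Set (BondConfig (Fin n))) (y z b : Fin n) :
    Q ∩ openConn y b ∩ (openConn y z)ᶜ = Q ∩ (openConn y b \ openConn z b) := by
  ext ω
  simp only [mem_inter_iff, mem_compl_iff, mem_sdiff]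
  constructor
  · rintro ⟨⟨hQ, hyb⟩, hyz⟩
    exact ⟨hQ, hyb, fun hzb => hyz (conn_trans hyb (conn_symm hzb))⟩
  · rintro ⟨hQ, hyb, hzb⟩
    exact ⟨⟨hQ, hyb⟩, fun hyz => hzb (conn_trans (conn_symm hyz) hyb)⟩

/-- `Q ∩ {z↔b} ∩ {y↮z} = Q ∩ ({z↔b} ∖ {y↔b})`: given `z ↔ b`, `y ↮ z ⟺ y ↮ b`. [folklore] -/
theorem r3pp_inter_conn_inter_compl_eq' (Q : Set (BondConfig (Fin n))) (y z b : Fin n) :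
    Q ∩ openConn z b ∩ (openConn y z)ᶜ = Q ∩ (openConn z b \ openConn y b) := by
  ext ω
  simp only [mem_inter_iff, mem_compl_iff, mem_sdiff]
  constructor
  · rintro ⟨⟨hQ, hzb⟩, hyz⟩
    exact ⟨hQ, hzb, fun hyb => hyz (conn_trans hyb (conn_symm hzb))⟩
  · rintro ⟨hQ, hzb, hyb⟩
    exact ⟨⟨hQ, hzb⟩, fun hyz => hyb (conn_trans hyz hzb)⟩

/-! ### The BHK step (T1) -/

/-- **(T1)** `μ(W)·μ({x↔y} ∩ D) ≤ μ(D_a)·μ({o↔y} ∩ D)` for `D = {y ↮ z}`, `D_a = {x ↮ y} ∩ {x ↮ z}`,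
`W = D_a ∩ {o ↔ x}`.  With `E := {x ↮ z}`, van den Berg–Häggström–Kahn's Theorem 1.3 for the cluster of `x`
given `E` and the increasing cluster functions `1{x↔o}`, `1{x↔y}` (`knLemma3i_oneCluster`) gives
`μ(E ∩ {o↔x})·μ(E ∩ {x↔y}) ≤ μ(E)·μ(E ∩ {o↔x} ∩ {x↔y})`; then use `{x↔y} ∩ D = E ∩ {x↔y}`,
`E ∩ {o↔x} ∩ {x↔y} ⊆ {o↔y} ∩ D`, `μ(D_a) = μ(E) − μ(E ∩ {x↔y})`, `μ(W) = μ(E ∩ {o↔x}) − μ(E ∩ {o↔x} ∩ {x↔y})`.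
[cite: VandenbergHaggstromKahn2005, Thm. 1.3 (p. 6)] -/
theorem r3pp_t1 (w : Sym2 (Fin n) → unitInterval) (o x y z : Fin n) (hxz : x ≠ z) :
    (prodBernoulli w).real (((openConn x y)ᶜ ∩ (openConn x z)ᶜ) ∩ openConn o x) *
        (prodBernoulli w).real (openConn x y ∩ (openConn y z)ᶜ) ≤
      (prodBernoulli w).real ((openConn x y)ᶜ ∩ (openConn x z)ᶜ) *
        (prodBernoulli w).real (openConn o y ∩ (openConn y z)ᶜ) := by
  set μ := prodBernoulli w with hμ
  -- BHK Thm. 1.3: source `x`, conditioning set `{z}`, `f = 1{x↔o}`, `g = 1{x↔y}`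
  have bhk := knLemma3i_oneCluster w x z o (openConn x y) (pivDom_openConn_mono_openEdgeCluster x y) hxz
  have hxo : (openConn x o : Set (BondConfig (Fin n))) = openConn o x := by
    ext η; exact ⟨fun h => conn_symm h, fun h => conn_symm h⟩
  rw [hxo] at bhk
  -- `μ(D_a) = μ(E) − μ(E ∩ {x↔y})`
  have e1 : μ.real ((openConn x y)ᶜ ∩ (openConn x z)ᶜ : Set (BondConfig (Fin n))) =
      μ.real (openConn x z : Set (BondConfig (Fin n)))ᶜ -
        μ.real ((openConn x z)ᶜ ∩ openConn x y : Set (BondConfig (Fin n))) := by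
    have h := measureReal_inter_add_sdiff (μ := μ) (s := (openConn x z : Set (BondConfig (Fin n)))ᶜ)
      (t := openConn x y) MeasurableSet.of_discrete
    have hs : (openConn x z : Set (BondConfig (Fin n)))ᶜ \ openConn x y =
        (openConn x y)ᶜ ∩ (openConn x z)ᶜ := by
      ext ω; simp only [mem_sdiff, mem_compl_iff, mem_inter_iff]; tauto
    rw [hs] at h
    linarith
  -- `μ(W) = μ(E ∩ {o↔x}) − μ(E ∩ ({o↔x} ∩ {x↔y}))`
  have e2 : μ.real (((openConn x y)ᶜ ∩ (openConn x z)ᶜ) ∩ openConn o x : Set (BondConfig (Fin n))) =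
      μ.real ((openConn x z)ᶜ ∩ openConn o x : Set (BondConfig (Fin n))) -
        μ.real ((openConn x z)ᶜ ∩ (openConn o x ∩ openConn x y) : Set (BondConfig (Fin n))) := by
    have h := measureReal_inter_add_sdiff (μ := μ)
      (s := ((openConn x z)ᶜ ∩ openConn o x : Set (BondConfig (Fin n)))) (t := openConn x y)
      MeasurableSet.of_discrete
    have hs1 : ((openConn x z)ᶜ ∩ openConn o x : Set (BondConfig (Fin n))) ∩ openConn x y =
        (openConn x z)ᶜ ∩ (openConn o x ∩ openConn x y) := inter_assoc _ _ _
    have hs2 : ((openConn x z)ᶜ ∩ openConn o x : Set (BondConfig (Fin n))) \ openConn x y =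
        ((openConn x y)ᶜ ∩ (openConn x z)ᶜ) ∩ openConn o x := by
      ext ω; simp only [mem_sdiff, mem_compl_iff, mem_inter_iff]; tauto
    rw [hs1, hs2] at h
    linarith
  -- `{x↔y} ∩ D = E ∩ {x↔y}` (given `x ↔ y`: `y ↮ z ⟺ x ↮ z`)
  have e3 : (openConn x y ∩ (openConn y z)ᶜ : Set (BondConfig (Fin n))) = (openConn x z)ᶜ ∩ openConn x y := by
    ext ω
    simp only [mem_inter_iff, mem_compl_iff]
    constructor
    · rintro ⟨hxy, hyz⟩
      exact ⟨fun hxz' => hyz (conn_trans (conn_symm hxy) hxz'), hxy⟩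
    · rintro ⟨hxz', hxy⟩
      exact ⟨hxy, fun hyz => hxz' (conn_trans hxy hyz)⟩
  -- `E ∩ {o↔x} ∩ {x↔y} ⊆ {o↔y} ∩ D` (`o ↔ x ↔ y`; and `y ↔ z` would give `x ↔ z`)
  have e4 : ((openConn x z)ᶜ ∩ (openConn o x ∩ openConn x y) : Set (BondConfig (Fin n))) ⊆
      openConn o y ∩ (openConn y z)ᶜ := by
    rintro ω ⟨hxz', hox, hxy⟩
    exact ⟨conn_trans hox hxy, fun hyz => hxz' (conn_trans hxy hyz)⟩
  have m4 := measureReal_mono (μ := μ) e4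
  have mq : μ.real ((openConn x z)ᶜ ∩ openConn x y : Set (BondConfig (Fin n))) ≤
      μ.real (openConn x z : Set (BondConfig (Fin n)))ᶜ := measureReal_mono inter_subset_left
  rw [e1, e2, e3]
  nlinarith [mul_nonneg (sub_nonneg.2 mq) (sub_nonneg.2 m4), bhk]

/-! ### `(R3″)` from `S12` -/

/-- **`(R3″)` from the summed slack inequality `S12`.**  With `D = {y ↮ z}`, `D_a = {x ↮ y} ∩ {x ↮ z}`,
`W = D_a ∩ {o ↔ x}` and, for `Q ∈ {{x↔y}, {o↔y}}`,
`s12(Q) = μ(D)·(μ(Q ∩ {y↔b} ∩ D) − μ(Q ∩ {z↔b} ∩ D)) − μ(Q ∩ D)·(μ(y↔b) − μ(z↔b))`,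
`L(Q) = μ(Q ∩ ({y↔b} ∖ {z↔b})) − μ(Q ∩ ({z↔b} ∖ {y↔b}))`: if `μ(z↔b) ≤ μ(y↔b)` and
`μ(W)·s12({x↔y}) ≤ μ(D_a)·s12({o↔y})`, then `μ(W)·L({x↔y}) ≤ μ(D_a)·L({o↔y})`.
Proof: by (I1) `L(Q) = μ(Q ∩ {y↔b} ∩ D) − μ(Q ∩ {z↔b} ∩ D)`, so
`μ(D)·[μ(D_a)·L(oy) − μ(W)·L(xy)]
   = [μ(D_a)·s12(oy) − μ(W)·s12(xy)] + (μ(y↔b) − μ(z↔b))·[μ(D_a)·μ(oy ∩ D) − μ(W)·μ(xy ∩ D)]`,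
nonnegative by the hypothesis and (T1); divide by `μ(D) > 0`, and if `μ(D) = 0` all `L`-terms vanish.
[cite: KozmaNitzan2024, Question 7 (p. 36)] -/
theorem r3pp_of_s12 (w : Sym2 (Fin n) → unitInterval) (o b x y z : Fin n) (hxz : x ≠ z)
    (hyz : (prodBernoulli w).real (openConn z b) ≤ (prodBernoulli w).real (openConn y b))
    (hS12 : (prodBernoulli w).real (((openConn x y)ᶜ ∩ (openConn x z)ᶜ) ∩ openConn o x) *
          ((prodBernoulli w).real (openConn y z)ᶜ *
              ((prodBernoulli w).real (openConn x y ∩ openConn y b ∩ (openConn y z)ᶜ) -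
                (prodBernoulli w).real (openConn x y ∩ openConn z b ∩ (openConn y z)ᶜ)) -
            (prodBernoulli w).real (openConn x y ∩ (openConn y z)ᶜ) *
              ((prodBernoulli w).real (openConn y b) - (prodBernoulli w).real (openConn z b))) ≤
        (prodBernoulli w).real ((openConn x y)ᶜ ∩ (openConn x z)ᶜ) *
          ((prodBernoulli w).real (openConn y z)ᶜ *
              ((prodBernoulli w).real (openConn o y ∩ openConn y b ∩ (openConn y z)ᶜ) -
                (prodBernoulli w).real (openConn o y ∩ openConn z b ∩ (openConn y z)ᶜ)) -
            (prodBernoulli w).real (openConn o y ∩ (openConn y z)ᶜ) *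
              ((prodBernoulli w).real (openConn y b) - (prodBernoulli w).real (openConn z b)))) :
    (prodBernoulli w).real (((openConn x y)ᶜ ∩ (openConn x z)ᶜ) ∩ openConn o x) *
        ((prodBernoulli w).real (openConn x y ∩ (openConn y b \ openConn z b)) -
          (prodBernoulli w).real (openConn x y ∩ (openConn z b \ openConn y b))) ≤
      (prodBernoulli w).real ((openConn x y)ᶜ ∩ (openConn x z)ᶜ) *
        ((prodBernoulli w).real (openConn o y ∩ (openConn y b \ openConn z b)) -
          (prodBernoulli w).real (openConn o y ∩ (openConn z b \ openConn y b))) := by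
  -- (I1): the `D`-restricted terms of `s12` are the `L`-terms
  rw [r3pp_inter_conn_inter_compl_eq (openConn x y) y z b, r3pp_inter_conn_inter_compl_eq' (openConn x y) y z b,
    r3pp_inter_conn_inter_compl_eq (openConn o y) y z b, r3pp_inter_conn_inter_compl_eq' (openConn o y) y z b]
    at hS12
  have t1 := r3pp_t1 w o x y z hxz
  -- the `L`-terms are at most `μ(D)`
  have bYx : (prodBernoulli w).real (openConn x y ∩ (openConn y b \ openConn z b)) ≤
      (prodBernoulli w).real (openConn y z : Set (BondConfig (Fin n)))ᶜ := by
    rw [← r3pp_inter_conn_inter_compl_eq]; exact measureReal_mono inter_subset_right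
  have bZx : (prodBernoulli w).real (openConn x y ∩ (openConn z b \ openConn y b)) ≤
      (prodBernoulli w).real (openConn y z : Set (BondConfig (Fin n)))ᶜ := by
    rw [← r3pp_inter_conn_inter_compl_eq']; exact measureReal_mono inter_subset_right
  have bYo : (prodBernoulli w).real (openConn o y ∩ (openConn y b \ openConn z b)) ≤
      (prodBernoulli w).real (openConn y z : Set (BondConfig (Fin n)))ᶜ := by
    rw [← r3pp_inter_conn_inter_compl_eq]; exact measureReal_mono inter_subset_right
  have bZo : (prodBernoulli w).real (openConn o y ∩ (openConn z b \ openConn y b)) ≤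
      (prodBernoulli w).real (openConn y z : Set (BondConfig (Fin n)))ᶜ := by
    rw [← r3pp_inter_conn_inter_compl_eq']; exact measureReal_mono inter_subset_right
  set μ := prodBernoulli w with hμ
  set d := μ.real (openConn y z : Set (BondConfig (Fin n)))ᶜ with hd
  set mW := μ.real (((openConn x y)ᶜ ∩ (openConn x z)ᶜ) ∩ openConn o x : Set (BondConfig (Fin n))) with hmW
  set mA := μ.real ((openConn x y)ᶜ ∩ (openConn x z)ᶜ : Set (BondConfig (Fin n))) with hmA
  set Yx := μ.real (openConn x y ∩ (openConn y b \ openConn z b) : Set (BondConfig (Fin n))) with hYx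
  set Zx := μ.real (openConn x y ∩ (openConn z b \ openConn y b) : Set (BondConfig (Fin n))) with hZx
  set Yo := μ.real (openConn o y ∩ (openConn y b \ openConn z b) : Set (BondConfig (Fin n))) with hYo
  set Zo := μ.real (openConn o y ∩ (openConn z b \ openConn y b) : Set (BondConfig (Fin n))) with hZo
  set XD := μ.real (openConn x y ∩ (openConn y z)ᶜ : Set (BondConfig (Fin n))) with hXD
  set OD := μ.real (openConn o y ∩ (openConn y z)ᶜ : Set (BondConfig (Fin n))) with hOD
  set β := μ.real (openConn y b : Set (BondConfig (Fin n))) with hβ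
  set γ := μ.real (openConn z b : Set (BondConfig (Fin n))) with hγ
  -- (I3) + assembly: `μ(D)·[μ(D_a)·L(oy) − μ(W)·L(xy)] ≥ 0`
  have key : 0 ≤ d * (mA * (Yo - Zo) - mW * (Yx - Zx)) := by
    nlinarith [mul_nonneg (sub_nonneg.2 hyz) (sub_nonneg.2 t1), hS12]
  rcases (measureReal_nonneg : 0 ≤ d).eq_or_lt with h0 | hpos
  · -- `μ(D) = 0`: all four `L`-terms vanish
    have eYx : Yx = 0 := le_antisymm (by linarith) measureReal_nonneg
    have eZx : Zx = 0 := le_antisymm (by linarith) measureReal_nonneg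
    have eYo : Yo = 0 := le_antisymm (by linarith) measureReal_nonneg
    have eZo : Zo = 0 := le_antisymm (by linarith) measureReal_nonneg
    rw [eYx, eZx, eYo, eZo, sub_self, mul_zero, mul_zero]
  · have hX := (mul_nonneg_iff_of_pos_left hpos).1 key
    linarith

/-! ### Registered stub form (explicit `∀ n`, fully qualified) -/

/-- Registered stub form of `r3pp_of_s12`: `(R3″)` from the summed BHK-type slack inequality `S12 := S1 + S2`
(with (T1) proved inside), under `μ(z↔b) ≤ μ(y↔b)`; the hypotheses `x ≠ y`, `y ≠ z` are not needed.
[cite: KozmaNitzan2024, Question 7 (p. 36)] -/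
theorem stub_r3ppOfS12 : ∀ (n : ℕ) (w : Sym2 (Fin n) → unitInterval) (o b x y z : Fin n), x ≠ y → x ≠ z → y ≠ z → (Literature.Probability.LatticeModels.prodBernoulli w).real (Literature.Probability.Percolation.openConn z b) ≤ (Literature.Probability.LatticeModels.prodBernoulli w).real (Literature.Probability.Percolation.openConn y b) → (Literature.Probability.LatticeModels.prodBernoulli w).real (((Literature.Probability.Percolation.openConn x y)ᶜ ∩ (Literature.Probability.Percolation.openConn x z)ᶜ) ∩ Literature.Probability.Percolation.openConn o x) * ((Literature.Probability.LatticeModels.prodBernoulli w).real (Literature.Probability.Percolation.openConn y z)ᶜ * ((Literature.Probability.LatticeModels.prodBernoulli w).real (Literature.Probability.Percolation.openConn x y ∩ Literature.Probability.Percolation.openConn y b ∩ (Literature.Probability.Percolation.openConn y z)ᶜ) - (Literature.Probability.LatticeModels.prodBernoulli w).real (Literature.Probability.Percolation.openConn x y ∩ Literature.Probability.Percolation.openConn z b ∩ (Literature.Probability.Percolation.openConn y z)ᶜ)) - (Literature.Probability.LatticeModels.prodBernoulli w).real (Literature.Probability.Percolation.openConn x y ∩ (Literature.Probability.Percolation.openConn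 y z)ᶜ) * ((Literature.Probability.LatticeModels.prodBernoulli w).real (Literature.Probability.Percolation.openConn y b) - (Literature.Probability.LatticeModels.prodBernoulli w).real (Literature.Probability.Percolation.openConn z b))) ≤ (Literature.Probability.LatticeModels.prodBernoulli w).real ((Literature.Probability.Percolation.openConn x y)ᶜ ∩ (Literature.Probability.Percolation.openConn x z)ᶜ) * ((Literature.Probability.LatticeModels.prodBernoulli w).real (Literature.Probability.Percolation.openConn y z)ᶜ * ((Literature.Probability.LatticeModels.prodBernoulli w).real (Literature.Probability.Percolation.openConn o y ∩ Literature.Probability.Percolation.openConn y b ∩ (Literature.Probability.Percolation.openConn y z)ᶜ) - (Literature.Probability.LatticeModels.prodBernoulli w).real (Literature.Probability.Percolation.openConn o y ∩ Literature.Probability.Percolation.openConn z b ∩ (Literature.Probability.Percolation.openConn y z)ᶜ)) - (Literature.Probability.LatticeModels.prodBernoulli w).real (Literature.Probability.Percolation.openConn o y ∩ (Literature.Probability.Percolation.openConn y z)ᶜ) * ((Literature.Probability.LatticeModels.prodBernoulli w).real (Literature.Probability.Percolation.openConn y b) - (Literature.Probability.LatticeModels.prodBernoulli w).real (Literature.Probability.Percolation.openConn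 z b))) → (Literature.Probability.LatticeModels.prodBernoulli w).real (((Literature.Probability.Percolation.openConn x y)ᶜ ∩ (Literature.Probability.Percolation.openConn x z)ᶜ) ∩ Literature.Probability.Percolation.openConn o x) * ((Literature.Probability.LatticeModels.prodBernoulli w).real (Literature.Probability.Percolation.openConn x y ∩ (Literature.Probability.Percolation.openConn y b \ Literature.Probability.Percolation.openConn z b)) - (Literature.Probability.LatticeModels.prodBernoulli w).real (Literature.Probability.Percolation.openConn x y ∩ (Literature.Probability.Percolation.openConn z b \ Literature.Probability.Percolation.openConn y b))) ≤ (Literature.Probability.LatticeModels.prodBernoulli w).real ((Literature.Probability.Percolation.openConn x y)ᶜ ∩ (Literature.Probability.Percolation.openConn x z)ᶜ) * ((Literature.Probability.LatticeModels.prodBernoulli w).real (Literature.Probability.Percolation.openConn o y ∩ (Literature.Probability.Percolation.openConn y b \ Literature.Probability.Percolation.openConn z b)) - (Literature.Probability.LatticeModels.prodBernoulli w).real (Literature.Probability.Percolation.openConn o y ∩ (Literature.Probability.Percolation.openConn z b \ Literature.Probability.Percolation.openConn y b))) :=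
  fun _ w o b x y z _ hxz _ hyz hS12 => r3pp_of_s12 w o b x y z hxz hyz hS12

end

end Summit.CriticalPhenomena.PercolationContinuityZ3.Theorems
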